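import Literature.Analysis.OperatorTheory.Enflo2023.LimitStep
import Literature.Analysis.OperatorTheory.Enflo2023.RoomClaim
import HarnessLib

/-!
# Enflo 2023, v2 p.20: what the room claims would give — rooms ⇒ Cauchy ⇒ (11) ⇒ invariant subspace

Source under adjudication: Per H. Enflo, *On the invariant subspace problem in Hilbert spaces*, arXiv:2305.15442 (v1
2023, v2 2024), bib key `Enflo2023` — a CLAIMED proof of the invariant subspace problem for operators on a separable
Hilbert space.  This file is part of the kernel-tight typing of the manuscript by the b2b-enflo repair cell
(formaliser 2, Part B: (28)–(47), the limiting argument and the final deduction).  It records what FOLLOWS (proved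
implications from the manuscript's displayed hypotheses) and, where a step does not follow, the typed inference
together with its refutation.  NOTHING here asserts that the manuscript's main theorem holds; no declaration concludes
the invariant subspace problem for an arbitrary operator.  Value (BLOCK-2b): theorems / refutations of typed
inferences about a text — not progress on the problem.

EnfloISP — Part B (formaliser 2).  v2 p.20: what DOES follow at the gap.  IF room bounds ρ_k → 0 held from pivots
n_k on (the paper's δ₂^40, δ₂^400, …), the iterates [ ]⁻¹_n x₀ would be Cauchy (`cauchySeq_of_rooms`,
RoomClaim.lean), hence norm convergent, and (11) (LimitStep.lean) would give the invariant subspace.  So the type-1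
gap is exactly the room claim (refuted as an inference in RoomClaim.lean: `not_roomClaim`). STATUS: CLOSED (zero
sorry), conditional on the room hypothesis which is displayed as such.
-/

open scoped InnerProductSpace
open Filter Topology RCLike

namespace Literature.Analysis.OperatorTheory.Enflo2023

section Rooms

variable {H : Type*} [NormedAddCommGroup H] [InnerProductSpace ℂ H]

/-- THE TYPE-1 CONCLUSION, CONDITIONAL ON THE ROOM CLAIMS.  Data: `T`; `‖x₀‖ = 1`; the MC sequence
`v n` = [ ]⁻¹_n x₀ with `0.3 ≤ ‖v n‖ ≤ 0.7` (so `ℓ_n(T)y_n = x₀ − v n` stays at distance ∈ [0.3, 0.7] from x₀);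
(9): `|⟨T^j ℓ_n(T)y_n, x₀ − ℓ_n(T)y_n⟩| ≤ (εθ)_n → 0`; and ROOMS `ρ k → 0` from pivots `p k`.  Then `T` has a
non-trivial closed invariant subspace.  Everything here is closed; the rooms are the unproved input. [cite: Enflo2023, v2 p.20, after (46)] -/
theorem hasNontrivialClosedInvariantSubspace_of_rooms [CompleteSpace H] (T : H →L[ℂ] H) (x₀ : H)
    (hx₀ : ‖x₀‖ = 1) (v : ℕ → H) (εθ : ℕ → ℝ)
    (hnorm : ∀ n, (0.3 : ℝ) ≤ ‖v n‖ ∧ ‖v n‖ ≤ 0.7)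
    (h9 : ∀ n j, ‖⟪v n, (T ^ j) (x₀ - v n)⟫_ℂ‖ ≤ εθ n) (hεθ : Tendsto εθ atTop (𝓝 0))
    (p : ℕ → ℕ) (ρ : ℕ → ℝ) (hroom : ∀ k n, p k ≤ n → ‖v n - v (p k)‖ ≤ ρ k)
    (hρ : Tendsto ρ atTop (𝓝 0)) :
    HasNontrivialClosedInvariantSubspace T := by
  obtain ⟨vlim, hv⟩ := cauchySeq_tendsto_of_complete (cauchySeq_of_rooms v p ρ hroom hρ)
  -- w n := x₀ - v n → x₀ - vlim
  have hw : Tendsto (fun n => x₀ - v n) atTop (𝓝 (x₀ - vlim)) := tendsto_const_nhds.sub hv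
  refine hasNontrivialClosedInvariantSubspace_of_norm_convergent_MC T x₀ (fun n => x₀ - v n) (x₀ - vlim)
    εθ hx₀ (fun n => ?_) hw hεθ (fun n j => ?_)
  · simpa using hnorm n
  · simpa using h9 n j

end Rooms

end Literature.Analysis.OperatorTheory.Enflo2023
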